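import Summits.AtomisticToContinuum.BoseEinsteinCondensation.Theorems.BECConjugateDominationPositiveMinimiserFreeHeat
import Mathlib.Analysis.Complex.Exponential
import HarnessLib

/-!
# Route `BECConjugateDomination`, support item `PositiveMinimiser` — small-time expansion of the
# periodic Feynman–Kac functional against the free heat operator, I: pathwise bounds

Step of the `C³` regularity of the periodic Feynman–Kac ground state
(item stmt-AtomisticToContinuum-11787). For a measurable pair potential with bounded
periodisation `v^per ≤ C` whose real interaction `W = (∑_{i<j} v^per(xᵢ - xⱼ)).toReal` is Lipschitz,
and a continuous periodic real `Ψ₀` (bounded, uniformly continuous), UNIFORMLY in the base point: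

  `P_t Ψ₀ (X) - (e^{-tH} Ψ₀)(X) = t · W(X) Ψ₀(X) + o(t)`   (`t → 0⁺`)

(proved in part II): write `P_tΨ₀ - e^{-tH}Ψ₀ = E[(1 - e^{-A_t}) Ψ₀(B_t)]` with the action
`A_t = ∫₀ᵗ W(B_s) ds ≤ N²Ct`. This file gives the PATHWISE bounds: the action against `tW(X)`
(`abs_toReal_periodicPathAction_sub_le`: `|A_t - tW(X)| ≤ t·G·√2∑ runSup`, running suprema of the
Brownian coordinates), the pointwise bound of the integrand (`abs_smallTime_integrand_le`: the
split `(1 - e^{-A} - A)Ψ₀(B_t)`, `(A - tW(X))Ψ₀(B_t)`, `tW(X)(Ψ₀(B_t) - Ψ₀(X))`), and uniform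
continuity read through an indicator (`abs_sub_le_eta_add_indicator`). [folklore]
-/

noncomputable section

namespace Summit.AtomisticToContinuum.BoseEinsteinCondensation.Theorems.PositiveMinimiser

open MeasureTheory ProbabilityTheory Filter Set Metric
open scoped ENNReal NNReal Topology
open Literature.MathematicalPhysics.QuantumManyBody.BoseGas
open Literature.Probability.Process (brownian runSup runSup_nonneg)

variable {N : ℕ} {v : ℝ → ℝ≥0∞} {L : ℝ} {C : ℝ≥0}

/-! ### The real interaction -/

/-- The real interaction `W = (∑_{i<j} v^per).toReal` is bounded by `N²C` for `v^per ≤ C`. [folklore] -/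
theorem toReal_periodicInteraction_le (hC : ∀ x, periodizedPotential v L x ≤ C) (X : Config N) :
    (periodicInteraction v L X).toReal ≤ ((N * N : ℕ) : ℝ) * C := by
  have h := periodicInteraction_le_of_bound (C := (C : ℝ≥0∞)) (fun x => hC x) X
  have hfin : ((N * N : ℕ) : ℝ≥0∞) * (C : ℝ≥0∞) ≠ ⊤ :=
    ENNReal.mul_ne_top (ENNReal.natCast_ne_top _) ENNReal.coe_ne_top
  have := ENNReal.toReal_mono hfin h
  rw [ENNReal.toReal_mul] at this
  simpa using this

/-- The periodic interaction is finite for `v^per ≤ C`. [folklore] -/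
theorem periodicInteraction_ne_top (hC : ∀ x, periodizedPotential v L x ≤ C) (X : Config N) :
    periodicInteraction v L X ≠ ⊤ :=
  ne_top_of_le_ne_top (ENNReal.mul_ne_top (ENNReal.natCast_ne_top _) ENNReal.coe_ne_top)
    (periodicInteraction_le_of_bound (C := (C : ℝ≥0∞)) (fun x => hC x) X)

/-! ### The action along a path against `t W(X)` -/

/-- **Pathwise comparison of the action with `t W(X)`**: if `W = V^per.toReal` is `G`-Lipschitz then
`|∫₀ᵗ W(B_s) ds - t W(X)| ≤ t · G · √2 ∑ᵢₖ runSup t (ω i k)` (the displacement up to time `t` is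
bounded by the running suprema of the coordinates). [folklore] -/
theorem abs_toReal_periodicPathAction_sub_le (hC : ∀ x, periodizedPotential v L x ≤ C)
    {G : ℝ} (hG : 0 ≤ G)
    (hlip : ∀ Y Z : Config N, |(periodicInteraction v L Y).toReal - (periodicInteraction v L Z).toReal|
      ≤ G * ‖Y - Z‖)
    (t : ℝ≥0) (X : Config N) (ω : PathSpace N) :
    |(periodicPathAction v L t X ω).toReal - t * (periodicInteraction v L X).toReal| ≤
      t * (G * (Real.sqrt 2 * ∑ i, ∑ k, runSup t (ω i k))) := by
  set W : Config N → ℝ := fun Y => (periodicInteraction v L Y).toReal with hW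
  set R : ℝ := Real.sqrt 2 * ∑ i, ∑ k, runSup t (ω i k) with hR
  have hR0 : 0 ≤ R := mul_nonneg (Real.sqrt_nonneg _)
    (Finset.sum_nonneg fun i _ => Finset.sum_nonneg fun k _ => runSup_nonneg _ _)
  have hW0 : ∀ Y, 0 ≤ W Y := fun Y => ENNReal.toReal_nonneg
  -- along the path, for `s ∈ (0, t]`: `|W(B_s) - W(X)| ≤ G R`
  have hpath : ∀ s ∈ Ioc (0 : ℝ) t, |W (worldLine X ω s.toNNReal) - W X| ≤ G * R := by
    intro s hs
    have hst : s.toNNReal ≤ t := by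
      rw [← NNReal.coe_le_coe, Real.coe_toNNReal _ hs.1.le]; exact hs.2
    have h1 := hlip (worldLine X ω s.toNNReal) X
    rw [worldLine_eq_add_displacement, add_sub_cancel_left] at h1
    exact h1.trans (mul_le_mul_of_nonneg_left (norm_displacement_le_sum_runSup hst ω) hG)
  have hV : ∀ Y, periodicInteraction v L Y = ENNReal.ofReal (W Y) := fun Y => by
    rw [hW, ENNReal.ofReal_toReal (periodicInteraction_ne_top hC Y)]
  -- upper bound for the action
  have hup : periodicPathAction v L t X ω ≤ ENNReal.ofReal (t * (W X + G * R)) := by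
    unfold periodicPathAction
    calc ∫⁻ s in Ioc (0 : ℝ) t, periodicInteraction v L (worldLine X ω s.toNNReal)
        ≤ ∫⁻ _s in Ioc (0 : ℝ) t, ENNReal.ofReal (W X + G * R) := by
          refine setLIntegral_mono' measurableSet_Ioc fun s hs => ?_
          rw [hV]
          refine ENNReal.ofReal_le_ofReal ?_
          linarith [(abs_le.1 (hpath s hs)).2]
      _ = ENNReal.ofReal (t * (W X + G * R)) := by
          rw [setLIntegral_const, Real.volume_Ioc, sub_zero, ENNReal.ofReal_mul t.coe_nonneg, mul_comm]
  -- lower bound for the action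
  have hlow : ENNReal.ofReal (t * (W X - G * R)) ≤ periodicPathAction v L t X ω := by
    unfold periodicPathAction
    calc ENNReal.ofReal (t * (W X - G * R))
        = ∫⁻ _s in Ioc (0 : ℝ) t, ENNReal.ofReal (W X - G * R) := by
          rw [setLIntegral_const, Real.volume_Ioc, sub_zero, ENNReal.ofReal_mul t.coe_nonneg, mul_comm]
      _ ≤ ∫⁻ s in Ioc (0 : ℝ) t, periodicInteraction v L (worldLine X ω s.toNNReal) := by
          refine setLIntegral_mono' measurableSet_Ioc fun s hs => ?_
          rw [hV]
          refine ENNReal.ofReal_le_ofReal ?_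
          linarith [(abs_le.1 (hpath s hs)).1]
  have hfin : periodicPathAction v L t X ω ≠ ⊤ := periodicPathAction_ne_top hC t X ω
  have h1 : (periodicPathAction v L t X ω).toReal ≤ t * (W X + G * R) :=
    ENNReal.toReal_le_of_le_ofReal (mul_nonneg t.coe_nonneg (add_nonneg (hW0 X) (mul_nonneg hG hR0))) hup
  have h2 : t * (W X - G * R) ≤ (periodicPathAction v L t X ω).toReal := by
    rcases le_or_gt 0 (t * (W X - G * R)) with h | h
    · rw [← ENNReal.ofReal_le_ofReal_iff ENNReal.toReal_nonneg, ENNReal.ofReal_toReal hfin]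
      exact hlow
    · exact h.le.trans ENNReal.toReal_nonneg
  rw [abs_le]
  constructor <;> nlinarith [h1, h2]

/-! ### Pointwise bound of the integrand -/

/-- **Pointwise bound of the small-time integrand.** With `B = X + √2 b_t`, weight `w = e^{-A}`,
action `A ≤ N²Ct ≤ 1`, `|A - tW(X)| ≤ tGR`, `|W(X)| ≤ N²C`, `|Ψ₀| ≤ M`:
`|Ψ₀(B) - wΨ₀(B) - tW(X)Ψ₀(X)| ≤ M(N²Ct)² + tMGR + tN²C|Ψ₀(B) - Ψ₀(X)|`. [folklore] -/
theorem abs_smallTime_integrand_le (hC : ∀ x, periodizedPotential v L x ≤ C)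
    {G : ℝ} (hG : 0 ≤ G)
    (hlip : ∀ Y Z : Config N, |(periodicInteraction v L Y).toReal - (periodicInteraction v L Z).toReal|
      ≤ G * ‖Y - Z‖)
    {Ψ₀ : Config N → ℝ} {M : ℝ} (hM : ∀ Y, |Ψ₀ Y| ≤ M) {t : ℝ≥0}
    (hsmall : ((N * N : ℕ) : ℝ) * C * t ≤ 1) (X : Config N) (ω : PathSpace N) :
    |Ψ₀ (X + displacement t ω) -
        (periodicFKWeight v L t X ω).toReal * Ψ₀ (X + displacement t ω) -
        t * ((periodicInteraction v L X).toReal * Ψ₀ X)| ≤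
      M * (((N * N : ℕ) : ℝ) * C * t) ^ 2 +
        t * (M * (G * (Real.sqrt 2 * ∑ i, ∑ k, runSup t (ω i k)))) +
        t * (((N * N : ℕ) : ℝ) * C) * |Ψ₀ (X + displacement t ω) - Ψ₀ X| := by
  have hM0 : 0 ≤ M := (abs_nonneg _).trans (hM 0)
  set CV : ℝ := ((N * N : ℕ) : ℝ) * C with hCV
  have hCV0 : 0 ≤ CV := by positivity
  set W : Config N → ℝ := fun Y => (periodicInteraction v L Y).toReal with hW
  set B : Config N := X + displacement t ω with hB
  set a : ℝ := (periodicPathAction v L t X ω).toReal with ha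
  set R : ℝ := Real.sqrt 2 * ∑ i, ∑ k, runSup t (ω i k) with hR
  have hR0 : 0 ≤ R := mul_nonneg (Real.sqrt_nonneg _)
    (Finset.sum_nonneg fun i _ => Finset.sum_nonneg fun k _ => runSup_nonneg _ _)
  have ha0 : 0 ≤ a := ENNReal.toReal_nonneg
  have haCV : a ≤ CV * t := by
    have hA : periodicPathAction v L t X ω ≤ (N * N : ℕ) * (C : ℝ≥0∞) * ENNReal.ofReal t :=
      periodicPathAction_le_of_bound (C := (C : ℝ≥0∞)) (fun x => hC x) t X ω
    have := ENNReal.toReal_mono (ENNReal.mul_ne_top (ENNReal.mul_ne_top (ENNReal.natCast_ne_top _)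
      ENNReal.coe_ne_top) ENNReal.ofReal_ne_top) hA
    rw [ENNReal.toReal_mul, ENNReal.toReal_mul, ENNReal.toReal_ofReal t.coe_nonneg] at this
    simpa [hCV] using this
  have ha1 : a ≤ 1 := haCV.trans hsmall
  have hw : (periodicFKWeight v L t X ω).toReal = Real.exp (-a) := toReal_periodicFKWeight_eq_exp hC t X ω
  have hWX : |W X| ≤ CV := by
    rw [abs_of_nonneg ENNReal.toReal_nonneg]; exact toReal_periodicInteraction_le hC X
  have hact : |a - t * W X| ≤ t * (G * R) := abs_toReal_periodicPathAction_sub_le hC hG hlip t X ω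
  -- the algebraic split
  have hsplit : Ψ₀ B - (periodicFKWeight v L t X ω).toReal * Ψ₀ B - t * (W X * Ψ₀ X) =
      -(Real.exp (-a) - 1 + a) * Ψ₀ B + (a - t * W X) * Ψ₀ B + t * W X * (Ψ₀ B - Ψ₀ X) := by
    rw [hw]; ring
  rw [hsplit]
  -- `|e^{-a} - 1 + a| ≤ a²` for `0 ≤ a ≤ 1`
  have hexp : |Real.exp (-a) - 1 + a| ≤ a ^ 2 := by
    have h := Real.abs_exp_sub_one_sub_id_le (x := -a) (by rw [abs_neg, abs_of_nonneg ha0]; exact ha1)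
    rw [neg_sq] at h
    simpa [sub_neg_eq_add] using h
  have e1 : |-(Real.exp (-a) - 1 + a) * Ψ₀ B| ≤ M * (CV * t) ^ 2 := by
    rw [abs_mul, abs_neg]
    calc |Real.exp (-a) - 1 + a| * |Ψ₀ B| ≤ a ^ 2 * M :=
          mul_le_mul hexp (hM B) (abs_nonneg _) (sq_nonneg _)
      _ ≤ (CV * t) ^ 2 * M := mul_le_mul_of_nonneg_right (pow_le_pow_left₀ ha0 haCV 2) hM0
      _ = M * (CV * t) ^ 2 := by ring
  have e2 : |(a - t * W X) * Ψ₀ B| ≤ t * (M * (G * R)) := by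
    rw [abs_mul]
    calc |a - t * W X| * |Ψ₀ B| ≤ t * (G * R) * M := mul_le_mul hact (hM B) (abs_nonneg _) (by positivity)
      _ = t * (M * (G * R)) := by ring
  have e3 : |t * W X * (Ψ₀ B - Ψ₀ X)| ≤ t * CV * |Ψ₀ B - Ψ₀ X| := by
    rw [abs_mul, abs_mul, abs_of_nonneg t.coe_nonneg]
    exact mul_le_mul_of_nonneg_right (mul_le_mul_of_nonneg_left hWX t.coe_nonneg) (abs_nonneg _)
  calc |-(Real.exp (-a) - 1 + a) * Ψ₀ B + (a - t * W X) * Ψ₀ B + t * W X * (Ψ₀ B - Ψ₀ X)|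
      ≤ |-(Real.exp (-a) - 1 + a) * Ψ₀ B| + |(a - t * W X) * Ψ₀ B| + |t * W X * (Ψ₀ B - Ψ₀ X)| :=
        (abs_add_le _ _).trans (add_le_add (abs_add_le _ _) le_rfl)
    _ ≤ M * (CV * t) ^ 2 + t * (M * (G * R)) + t * CV * |Ψ₀ B - Ψ₀ X| := add_le_add (add_le_add e1 e2) e3

/-- **Uniform continuity read through an indicator**: if `‖h‖ < δ ⇒ |Ψ₀(Y + h) - Ψ₀(Y)| ≤ η` and
`|Ψ₀| ≤ M`, then `|Ψ₀(X + h) - Ψ₀(X)| ≤ η + 2M · 𝟙{δ ≤ ‖h‖}`. [folklore] -/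
theorem abs_sub_le_eta_add_indicator {Ψ₀ : Config N → ℝ} {M : ℝ} (hM : ∀ Y, |Ψ₀ Y| ≤ M)
    {η δ : ℝ} (hη : 0 ≤ η) (hUC : ∀ Y h : Config N, ‖h‖ < δ → |Ψ₀ (Y + h) - Ψ₀ Y| ≤ η)
    (X h : Config N) :
    |Ψ₀ (X + h) - Ψ₀ X| ≤ η + 2 * M * Set.indicator {h' : Config N | δ ≤ ‖h'‖} (fun _ => (1 : ℝ)) h := by
  have hM0 : 0 ≤ M := (abs_nonneg _).trans (hM 0)
  by_cases hh : δ ≤ ‖h‖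
  · rw [Set.indicator_of_mem (show h ∈ {h' : Config N | δ ≤ ‖h'‖} from hh), mul_one]
    calc |Ψ₀ (X + h) - Ψ₀ X| ≤ |Ψ₀ (X + h)| + |Ψ₀ X| := abs_sub _ _
      _ ≤ M + M := add_le_add (hM _) (hM _)
      _ ≤ η + 2 * M := by linarith
  · rw [Set.indicator_of_notMem (show h ∉ {h' : Config N | δ ≤ ‖h'‖} from hh), mul_zero, add_zero]
    exact hUC X h (not_le.1 hh)

end Summit.AtomisticToContinuum.BoseEinsteinCondensation.Theorems.PositiveMinimiser

end
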